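import Summits.CriticalPhenomena.PercolationContinuityZ3.Theorems.PercNearOneGluingNoHeavyLowerTailSahiE3DnfTwoCert
import Summits.CriticalPhenomena.PercolationContinuityZ3.Theorems.PercNearOneGluingNoHeavyLowerTailSahiE3DnfPairAlgebraHom
import Mathlib.Tactic.Linarith
import Mathlib.Tactic.Ring
import Mathlib.Tactic.Positivity
import Mathlib.Tactic.FieldSimp
import Mathlib.Tactic.LinearCombination
import HarnessLib
import HarnessLib.Audit

/-!
# `NoHeavyLowerTail` (crux stmt-CriticalPhenomena-4575), Sahi programme P4: the explicit flow certificate for the OR of two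
# disjoint principal blocks (`(x₁∧…∧x_a) ∨ (y₁∧…∧y_b)`)

Support file (cell `prim-l12`, seat P4, generation 12; `--supports stmt-CriticalPhenomena-4575`).  No named facts, no sorries;
standard axioms; def-free.

THEOREM `cert_dnf_two`.  Let `Q_A`, `Q_B` be finite posets with greatest elements `t_A`, `t_B`, nonnegative weights `ν_A`, `ν_B`
with Harris' inequality for up-sets on `Q_B` and on `Q_A`, and `Δ' = ν_A(t_A)ν_B(Q_B∖t_B) + ν_A(Q_A∖t_A)ν_B(t_B) > 0`.  Then the slot
`U = {(a,b) | a = t_A ∨ b = t_B}` of `Q_A × Q_B` with the product weight carries a flow certificate with exact deliveries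
(conditions (R0), (F0), (F≤), (cap), (K)-with-equality, (pair) of `…SahiE3PatternCertificate.phi_nonneg_of_patternCertificate`):
every receiver `(a,b)` (`a ≠ t_A`, `b ≠ t_B`) sends the fraction `θ_A = ν_A(t_A)ν_B(Q_B∖t_B)/Δ'` of its due mass to `(t_A, b)` and
`θ_B = 1 − θ_A` to `(a, t_B)`; `R = Z(Z+N_D)ν − loads`.  The pair inequality is `…SahiE3DnfPairAlgebraHom.dnf_two_pair_hom` after the
face bookkeeping of `…SahiE3DnfTwoCert`.  In the application `Q_A = (α → Bool)`, `Q_B = (β → Bool)` with product weights this is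
the pattern of the first slot `(x₁∧…∧x_a) ∨ (y₁∧…∧y_b)`; the lattice / Kahn-form corollaries are the successor's files (blueprint:
HOME prim-l12-p4/FROM-prim-l12-p4-gen12-CERTIFICATE-OBSTRUCTION.md §5).
-/

namespace Summit.CriticalPhenomena.PercolationContinuityZ3.Theorems.SahiE3DnfTwoCertMain

open Finset SahiE3DnfTwoCert SahiE3DnfPairAlgebraHom
open scoped BigOperators

variable {QA QB : Type*} [Fintype QA] [DecidableEq QA] [PartialOrder QA] [Fintype QB] [DecidableEq QB] [PartialOrder QB]

omit [Fintype QA] in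
/-- The section `{b | (c, b) ∈ S}` of an up-set of `Q_A × Q_B` is an up-set of `Q_B`. [folklore] -/
theorem isUpperSet_sectionB {S : Finset (QA × QB)} (hS : IsUpperSet (S : Set (QA × QB))) (c : QA) :
    IsUpperSet ((univ.filter fun b => (c, b) ∈ S : Finset QB) : Set QB) := by
  intro b b' hbb' hb
  simp only [Finset.coe_filter, Finset.mem_univ, true_and, Set.mem_setOf_eq] at hb ⊢
  exact hS (Prod.mk_le_mk.2 ⟨le_rfl, hbb'⟩) hb

omit [Fintype QB] in
/-- The section `{a | (a, c) ∈ S}` of an up-set of `Q_A × Q_B` is an up-set of `Q_A`. [folklore] -/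
theorem isUpperSet_sectionA {S : Finset (QA × QB)} (hS : IsUpperSet (S : Set (QA × QB))) (c : QB) :
    IsUpperSet ((univ.filter fun a => (a, c) ∈ S : Finset QA) : Set QA) := by
  intro a a' haa' ha
  simp only [Finset.coe_filter, Finset.mem_univ, true_and, Set.mem_setOf_eq] at ha ⊢
  exact hS (Prod.mk_le_mk.2 ⟨haa', le_rfl⟩) ha

/-- **The flow certificate of the OR of two disjoint principal blocks** (see the module docstring). [this work] -/
theorem cert_dnf_two {νA : QA → ℝ} {νB : QB → ℝ} (hνA : ∀ a, 0 ≤ νA a) (hνB : ∀ b, 0 ≤ νB b)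
    (tA : QA) (htA : ∀ a, a ≤ tA) (tB : QB) (htB : ∀ b, b ≤ tB)
    (hHA : ∀ S S' : Finset QA, IsUpperSet (S : Set QA) → IsUpperSet (S' : Set QA) →
      (∑ t ∈ S, νA t) * (∑ t ∈ S', νA t) ≤ (∑ t, νA t) * ∑ t ∈ S ∩ S', νA t)
    (hHB : ∀ S S' : Finset QB, IsUpperSet (S : Set QB) → IsUpperSet (S' : Set QB) →
      (∑ t ∈ S, νB t) * (∑ t ∈ S', νB t) ≤ (∑ t, νB t) * ∑ t ∈ S ∩ S', νB t)
    (hΔ : 0 < νA tA * (∑ b ∈ univ.filter (fun b => b ≠ tB), νB b) + (∑ a ∈ univ.filter (fun a => a ≠ tA), νA a) * νB tB)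
    (ν : QA × QB → ℝ) (hν : ∀ x, ν x = νA x.1 * νB x.2)
    (U : Finset (QA × QB)) (hU : ∀ x, x ∈ U ↔ (x.1 = tA ∨ x.2 = tB)) :
    ∃ (R : QA × QB → ℝ) (Fl : (QA × QB) → (QA × QB) → ℝ),
      (∀ t ∈ U, 0 ≤ R t) ∧ (∀ t s, 0 ≤ Fl t s) ∧ (∀ t s, Fl t s ≠ 0 → s ≤ t) ∧
      (∀ t ∈ U, R t + ∑ s ∈ Uᶜ, Fl t s ≤ (∑ r, ν r) * ((∑ r, ν r) + ∑ r ∈ Uᶜ, ν r) * ν t) ∧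
      (∀ s ∈ Uᶜ, ∑ t ∈ U, Fl t s = (∑ r, ν r) * (∑ r ∈ U, ν r) * ν s) ∧
      (∀ S S' : Finset (QA × QB), IsUpperSet (S : Set (QA × QB)) → IsUpperSet (S' : Set (QA × QB)) →
        (∑ r, ν r) * ((∑ t ∈ S, ν t) * (∑ t ∈ S' ∩ U, ν t) + (∑ t ∈ S', ν t) * (∑ t ∈ S ∩ U, ν t))
            - (∑ r ∈ U, ν r) * (∑ t ∈ S, ν t) * (∑ t ∈ S', ν t) ≤ ∑ t ∈ (S ∩ S') ∩ U, R t) := by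
  -- block masses
  set QA' := ∑ a ∈ univ.filter (fun a => a ≠ tA), νA a with hQA'
  set QB' := ∑ b ∈ univ.filter (fun b => b ≠ tB), νB b with hQB'
  set Dp := νA tA * QB' + QA' * νB tB with hDp
  have hPA : 0 ≤ νA tA := hνA tA; have hPB : 0 ≤ νB tB := hνB tB
  have hQA : 0 ≤ QA' := Finset.sum_nonneg fun a _ => hνA a; have hQB : 0 ≤ QB' := Finset.sum_nonneg fun b _ => hνB b
  have hZA : ∑ a, νA a = νA tA + QA' := sum_top_add tA νA
  have hZB : ∑ b, νB b = νB tB + QB' := sum_top_add tB νB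
  have hν0 : ∀ x, 0 ≤ ν x := fun x => by rw [hν]; exact mul_nonneg (hνA _) (hνB _)
  have hUc : Uᶜ = univ.filter (fun x : QA × QB => x.1 ≠ tA ∧ x.2 ≠ tB) := by
    ext x; simp only [Finset.mem_compl, hU, not_or, Finset.mem_filter, Finset.mem_univ, true_and]
  have eZ : ∑ r, ν r = (νA tA + QA') * (νB tB + QB') := by
    rw [show (∑ r, ν r) = ∑ r : QA × QB, νA r.1 * νB r.2 from Finset.sum_congr rfl fun r _ => hν r,
      sum_prod_weight, hZA, hZB]
  have eND : ∑ r ∈ Uᶜ, ν r = QA' * QB' := by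
    rw [hUc, show (∑ r ∈ univ.filter (fun x : QA × QB => x.1 ≠ tA ∧ x.2 ≠ tB), ν r) =
      ∑ r ∈ univ.filter (fun x : QA × QB => x.1 ≠ tA ∧ x.2 ≠ tB), νA r.1 * νB r.2 from
      Finset.sum_congr rfl fun r _ => hν r, sum_face00_univ]
  have eNU : ∑ r ∈ U, ν r = (νA tA + QA') * (νB tB + QB') - QA' * QB' := by
    have h := Finset.sum_add_sum_compl U ν
    rw [eND, eZ] at h; linarith
  set Z := (νA tA + QA') * (νB tB + QB') with hZdef
  set NU := (νA tA + QA') * (νB tB + QB') - QA' * QB' with hNUdef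
  have hZ0 : 0 ≤ Z := by positivity
  have hNU0 : 0 ≤ NU := by
    have : NU = νA tA * νB tB + νA tA * QB' + QA' * νB tB := by rw [hNUdef]; ring
    rw [this]; positivity
  set θA := νA tA * QB' / Dp with hθA
  set θB := QA' * νB tB / Dp with hθB
  have hθA0 : 0 ≤ θA := div_nonneg (mul_nonneg hPA hQB) hΔ.le; have hθB0 : 0 ≤ θB := div_nonneg (mul_nonneg hQA hPB) hΔ.le
  have hθsum : θA + θB = 1 := by
    rw [hθA, hθB, ← add_div, div_eq_one_iff_eq hΔ.ne']
  -- the certificate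
  set Fl : (QA × QB) → (QA × QB) → ℝ := fun t s =>
    if s ∈ U then 0 else ((if t = (tA, s.2) then θA * Z * NU * ν s else 0)
      + (if t = (s.1, tB) then θB * Z * NU * ν s else 0)) with hFl
  -- outflow of a donor
  have hout : ∀ t : QA × QB, ∑ s ∈ Uᶜ, Fl t s =
      (if t.1 = tA ∧ t.2 ≠ tB then θA * Z * NU * (νB t.2 * QA') else 0)
        + (if t.1 ≠ tA ∧ t.2 = tB then θB * Z * NU * (νA t.1 * QB') else 0) := by
    rintro ⟨a, b⟩
    dsimp only
    have e1 : ∑ s ∈ Uᶜ, Fl (a, b) s = ∑ s ∈ Uᶜ, ((if (a, b) = (tA, s.2) then θA * Z * NU * ν s else 0)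
        + (if (a, b) = (s.1, tB) then θB * Z * NU * ν s else 0)) :=
      Finset.sum_congr rfl fun s hs => by simp only [hFl, Finset.mem_compl.1 hs, ↓reduceIte]
    rw [e1, Finset.sum_add_distrib]
    congr 1
    · by_cases ha : a = tA ∧ b ≠ tB
      · rw [if_pos ha]
        have e2 : ∑ s ∈ Uᶜ, (if (a, b) = (tA, s.2) then θA * Z * NU * ν s else 0) =
            ∑ s ∈ Uᶜ.filter (fun s => s.2 = b), θA * Z * NU * ν s := by
          rw [Finset.sum_filter]
          refine Finset.sum_congr rfl fun s _ => ?_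
          have : ((a, b) = (tA, s.2)) ↔ s.2 = b := by
            rw [Prod.mk.injEq]; constructor
            · rintro ⟨_, h⟩; exact h.symm
            · intro h; exact ⟨ha.1, h.symm⟩
          simp only [this]
        rw [e2, hUc, Finset.filter_filter]
        have e3 : univ.filter (fun s : QA × QB => (s.1 ≠ tA ∧ s.2 ≠ tB) ∧ s.2 = b) =
            univ.filter (fun s : QA × QB => s.1 ≠ tA ∧ s.2 = b) := by
          ext s; simp only [Finset.mem_filter, Finset.mem_univ, true_and]
          constructor
          · rintro ⟨⟨h1, _⟩, h3⟩; exact ⟨h1, h3⟩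
          · rintro ⟨h1, h3⟩; exact ⟨⟨h1, by rw [h3]; exact ha.2⟩, h3⟩
        rw [e3, ← Finset.mul_sum]
        have e4 : ∑ s ∈ univ.filter (fun s : QA × QB => s.1 ≠ tA ∧ s.2 = b), ν s =
            ∑ s ∈ univ.filter (fun s : QA × QB => s.1 ≠ tA ∧ s.2 = b), νA s.1 * νB b :=
          Finset.sum_congr rfl fun s hs => by rw [hν, (Finset.mem_filter.1 hs).2.2]
        rw [e4, ← Finset.sum_mul, sum_snd_fixed tA b univ νA]
        have e5 : (univ.filter fun a' : QA => (a', b) ∈ (univ : Finset (QA × QB))).filter (fun a' => a' ≠ tA) =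
            univ.filter (fun a' => a' ≠ tA) := by ext a'; simp
        rw [e5]; ring
      · rw [if_neg ha]
        refine Finset.sum_eq_zero fun s hs => ?_
        rw [if_neg]
        rw [Prod.mk.injEq]
        rintro ⟨h1, h2⟩
        rw [hUc, Finset.mem_filter] at hs
        exact ha ⟨h1, by rw [h2]; exact hs.2.2⟩
    · by_cases hb : a ≠ tA ∧ b = tB
      · rw [if_pos hb]
        have e2 : ∑ s ∈ Uᶜ, (if (a, b) = (s.1, tB) then θB * Z * NU * ν s else 0) =
            ∑ s ∈ Uᶜ.filter (fun s => s.1 = a), θB * Z * NU * ν s := by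
          rw [Finset.sum_filter]
          refine Finset.sum_congr rfl fun s _ => ?_
          have : ((a, b) = (s.1, tB)) ↔ s.1 = a := by
            rw [Prod.mk.injEq]; constructor
            · rintro ⟨h, _⟩; exact h.symm
            · intro h; exact ⟨h.symm, hb.2⟩
          simp only [this]
        rw [e2, hUc, Finset.filter_filter]
        have e3 : univ.filter (fun s : QA × QB => (s.1 ≠ tA ∧ s.2 ≠ tB) ∧ s.1 = a) =
            univ.filter (fun s : QA × QB => s.1 = a ∧ s.2 ≠ tB) := by
          ext s; simp only [Finset.mem_filter, Finset.mem_univ, true_and]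
          constructor
          · rintro ⟨⟨_, h2⟩, h3⟩; exact ⟨h3, h2⟩
          · rintro ⟨h3, h2⟩; exact ⟨⟨by rw [h3]; exact hb.1, h2⟩, h3⟩
        rw [e3, ← Finset.mul_sum]
        have e4 : ∑ s ∈ univ.filter (fun s : QA × QB => s.1 = a ∧ s.2 ≠ tB), ν s =
            ∑ s ∈ univ.filter (fun s : QA × QB => s.1 = a ∧ s.2 ≠ tB), νA a * νB s.2 :=
          Finset.sum_congr rfl fun s hs => by rw [hν, (Finset.mem_filter.1 hs).2.1]
        rw [e4, ← Finset.mul_sum, sum_fst_fixed a tB univ νB]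
        have e5 : (univ.filter fun b' : QB => (a, b') ∈ (univ : Finset (QA × QB))).filter (fun b' => b' ≠ tB) =
            univ.filter (fun b' => b' ≠ tB) := by ext b'; simp
        rw [e5]
      · rw [if_neg hb]
        refine Finset.sum_eq_zero fun s hs => ?_
        rw [if_neg]
        rw [Prod.mk.injEq]
        rintro ⟨h1, h2⟩
        rw [hUc, Finset.mem_filter] at hs
        exact hb ⟨by rw [h1]; exact hs.2.1, h2⟩
  -- the key capacity inequality `QA' QB' NU ≤ (Z + QA' QB') Δ'`
  have hK : 0 ≤ Dp * Z - QA' * QB' * νA tA * νB tB := by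
    rw [hDp, hZdef]
    nlinarith [mul_nonneg (mul_nonneg hPA hQB) (mul_nonneg hPA hPB), mul_nonneg (mul_nonneg hPA hQB) (mul_nonneg hPA hQB),
      mul_nonneg (mul_nonneg hPA hQB) (mul_nonneg hQA hQB), mul_nonneg (mul_nonneg hQA hPB) (mul_nonneg hPA hPB),
      mul_nonneg (mul_nonneg hQA hPB) (mul_nonneg hQA hPB), mul_nonneg (mul_nonneg hQA hPB) (mul_nonneg hQA hQB),
      mul_nonneg (mul_nonneg hQA hPB) (mul_nonneg hPA hQB)]
  have hcapA : θA * NU * QA' ≤ (Z + QA' * QB') * νA tA := by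
    rw [hθA, div_mul_eq_mul_div, div_mul_eq_mul_div, div_le_iff₀ hΔ]
    have : NU = νA tA * νB tB + Dp := by rw [hNUdef, hDp]; ring
    rw [this]
    nlinarith [mul_nonneg hPA hK, mul_nonneg (mul_nonneg hPA hQB) (mul_nonneg hQA (mul_nonneg hPA hPB))]
  have hcapB : θB * NU * QB' ≤ (Z + QA' * QB') * νB tB := by
    rw [hθB, div_mul_eq_mul_div, div_mul_eq_mul_div, div_le_iff₀ hΔ]
    have : NU = νA tA * νB tB + Dp := by rw [hNUdef, hDp]; ring
    rw [this]
    nlinarith [mul_nonneg hPB hK, mul_nonneg (mul_nonneg hQA hPB) (mul_nonneg hQB (mul_nonneg hPA hPB))]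
  refine ⟨fun t => Z * (Z + QA' * QB') * ν t - ∑ s ∈ Uᶜ, Fl t s, Fl, ?_, ?_, ?_, ?_, ?_, ?_⟩
  · -- (R0)
    rintro ⟨a, b⟩ ht
    dsimp only
    rw [hout, hν]
    dsimp only
    by_cases h1 : a = tA ∧ b ≠ tB
    · have h2 : ¬ (a ≠ tA ∧ b = tB) := fun h => h.1 h1.1
      rw [if_pos h1, if_neg h2, add_zero, h1.1]
      have h3 := mul_le_mul_of_nonneg_left (mul_le_mul_of_nonneg_right hcapA (hνB b)) hZ0
      have e : Z * (Z + QA' * QB') * (νA tA * νB b) - θA * Z * NU * (νB b * QA') =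
          Z * ((Z + QA' * QB') * νA tA * νB b) - Z * (θA * NU * QA' * νB b) := by ring
      rw [e]; linarith
    · rw [if_neg h1, zero_add]
      by_cases h2 : a ≠ tA ∧ b = tB
      · rw [if_pos h2, h2.2]
        have h3 := mul_le_mul_of_nonneg_left (mul_le_mul_of_nonneg_right hcapB (hνA a)) hZ0
        have e : Z * (Z + QA' * QB') * (νA a * νB tB) - θB * Z * NU * (νA a * QB') =
            Z * ((Z + QA' * QB') * νB tB * νA a) - Z * (θB * NU * QB' * νA a) := by ring
        rw [e]; linarith
      · rw [if_neg h2, sub_zero]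
        exact mul_nonneg (mul_nonneg hZ0 (by positivity)) (mul_nonneg (hνA a) (hνB b))
  · -- (F0)
    intro t s
    by_cases hs : s ∈ U
    · simp only [hFl, hs, ↓reduceIte]; exact le_rfl
    · simp only [hFl, hs, ↓reduceIte]
      refine add_nonneg ?_ ?_
      · split_ifs
        · exact mul_nonneg (mul_nonneg (mul_nonneg hθA0 hZ0) hNU0) (hν0 s)
        · exact le_rfl
      · split_ifs
        · exact mul_nonneg (mul_nonneg (mul_nonneg hθB0 hZ0) hNU0) (hν0 s)
        · exact le_rfl
  · -- (F≤)
    rintro ⟨a, b⟩ ⟨a', b'⟩ h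
    simp only [hFl] at h
    by_cases hs : (a', b') ∈ U
    · exact absurd (by rw [if_pos hs]) h
    · rw [if_neg hs] at h
      by_cases e1 : ((a, b) : QA × QB) = (tA, b')
      · rw [Prod.mk.injEq] at e1
        rw [e1.1, e1.2]; exact Prod.mk_le_mk.2 ⟨htA a', le_rfl⟩
      · rw [if_neg e1, zero_add] at h
        by_cases e2 : ((a, b) : QA × QB) = (a', tB)
        · rw [Prod.mk.injEq] at e2
          rw [e2.1, e2.2]; exact Prod.mk_le_mk.2 ⟨le_rfl, htB b'⟩
        · exact absurd (by rw [if_neg e2]) h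
  · -- (cap) with equality
    intro t _
    dsimp only
    rw [eZ, eND]
    linarith
  · -- (K) with equality
    rintro ⟨a, b⟩ hs
    have hs' : ¬ ((a, b) ∈ U) := Finset.mem_compl.1 hs
    have ha : a ≠ tA := fun h => hs' ((hU _).2 (Or.inl h))
    have hb : b ≠ tB := fun h => hs' ((hU _).2 (Or.inr h))
    have e1 : ∑ t ∈ U, Fl t (a, b) = ∑ t ∈ U, ((if t = (tA, b) then θA * Z * NU * ν (a, b) else 0)
        + (if t = (a, tB) then θB * Z * NU * ν (a, b) else 0)) :=
      Finset.sum_congr rfl fun t _ => by simp only [hFl, hs', ↓reduceIte]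
    rw [e1, Finset.sum_add_distrib, Finset.sum_ite_eq' U (tA, b), Finset.sum_ite_eq' U (a, tB),
      if_pos ((hU _).2 (Or.inl rfl)), if_pos ((hU _).2 (Or.inr rfl)), eZ, eNU]
    calc θA * Z * NU * ν (a, b) + θB * Z * NU * ν (a, b) = (θA + θB) * Z * NU * ν (a, b) := by ring
      _ = Z * NU * ν (a, b) := by rw [hθsum, one_mul]
  · -- (pair)
    intro S T hS hT
    -- empty cases
    by_cases hS0 : (tA, tB) ∈ S
    swap
    · have hSe : S = ∅ := by
        rw [Finset.eq_empty_iff_forall_notMem]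
        intro x hx; exact hS0 (hS (show x ≤ (tA, tB) from Prod.mk_le_mk.2 ⟨htA x.1, htB x.2⟩) hx)
      subst hSe; simp
    by_cases hT0 : (tA, tB) ∈ T
    swap
    · have hTe : T = ∅ := by
        rw [Finset.eq_empty_iff_forall_notMem]
        intro x hx; exact hT0 (hT (show x ≤ (tA, tB) from Prod.mk_le_mk.2 ⟨htA x.1, htB x.2⟩) hx)
      subst hTe; simp
    have hW0 : (tA, tB) ∈ S ∩ T := Finset.mem_inter.2 ⟨hS0, hT0⟩
    -- face masses
    set σS := ∑ x ∈ S.filter (fun x => x.1 = tA ∧ x.2 ≠ tB), νB x.2 with hσS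
    set τS := ∑ x ∈ S.filter (fun x => x.1 ≠ tA ∧ x.2 = tB), νA x.1 with hτS
    set ρS := ∑ x ∈ S.filter (fun x => x.1 ≠ tA ∧ x.2 ≠ tB), νA x.1 * νB x.2 with hρS
    set σT := ∑ x ∈ T.filter (fun x => x.1 = tA ∧ x.2 ≠ tB), νB x.2 with hσT
    set τT := ∑ x ∈ T.filter (fun x => x.1 ≠ tA ∧ x.2 = tB), νA x.1 with hτT
    set ρT := ∑ x ∈ T.filter (fun x => x.1 ≠ tA ∧ x.2 ≠ tB), νA x.1 * νB x.2 with hρT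
    set σW := ∑ x ∈ (S ∩ T).filter (fun x => x.1 = tA ∧ x.2 ≠ tB), νB x.2 with hσW
    set τW := ∑ x ∈ (S ∩ T).filter (fun x => x.1 ≠ tA ∧ x.2 = tB), νA x.1 with hτW
    -- mass of an up-set containing the top, by faces
    have mass_of : ∀ X : Finset (QA × QB), (tA, tB) ∈ X →
        ∑ x ∈ X, ν x = νA tA * νB tB + νA tA * (∑ x ∈ X.filter (fun x => x.1 = tA ∧ x.2 ≠ tB), νB x.2)
          + νB tB * (∑ x ∈ X.filter (fun x => x.1 ≠ tA ∧ x.2 = tB), νA x.1)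
          + ∑ x ∈ X.filter (fun x => x.1 ≠ tA ∧ x.2 ≠ tB), νA x.1 * νB x.2 := by
      intro X hX
      rw [show (∑ x ∈ X, ν x) = ∑ x ∈ X, νA x.1 * νB x.2 from Finset.sum_congr rfl fun x _ => hν x,
        sum_faces tA tB X, sum_face11, if_pos hX, sum_face10_mul, sum_face01_mul]
    have massU_of : ∀ X : Finset (QA × QB), (tA, tB) ∈ X →
        ∑ x ∈ X ∩ U, ν x = νA tA * νB tB + νA tA * (∑ x ∈ X.filter (fun x => x.1 = tA ∧ x.2 ≠ tB), νB x.2)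
          + νB tB * (∑ x ∈ X.filter (fun x => x.1 ≠ tA ∧ x.2 = tB), νA x.1) := by
      intro X hX
      have hXU : (tA, tB) ∈ X ∩ U := Finset.mem_inter.2 ⟨hX, (hU _).2 (Or.inl rfl)⟩
      have f10 : (X ∩ U).filter (fun x => x.1 = tA ∧ x.2 ≠ tB) = X.filter (fun x => x.1 = tA ∧ x.2 ≠ tB) := by
        ext x; simp only [Finset.mem_filter, Finset.mem_inter, hU]
        constructor
        · rintro ⟨⟨h1, _⟩, h2⟩; exact ⟨h1, h2⟩
        · rintro ⟨h1, h2⟩; exact ⟨⟨h1, Or.inl h2.1⟩, h2⟩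
      have f01 : (X ∩ U).filter (fun x => x.1 ≠ tA ∧ x.2 = tB) = X.filter (fun x => x.1 ≠ tA ∧ x.2 = tB) := by
        ext x; simp only [Finset.mem_filter, Finset.mem_inter, hU]
        constructor
        · rintro ⟨⟨h1, _⟩, h2⟩; exact ⟨h1, h2⟩
        · rintro ⟨h1, h2⟩; exact ⟨⟨h1, Or.inr h2.2⟩, h2⟩
      have f00 : ∑ x ∈ (X ∩ U).filter (fun x => x.1 ≠ tA ∧ x.2 ≠ tB), νA x.1 * νB x.2 = 0 := by
        refine Finset.sum_eq_zero fun x hx => ?_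
        exfalso
        simp only [Finset.mem_filter, Finset.mem_inter, hU] at hx
        rcases hx.1.2 with h | h
        · exact hx.2.1 h
        · exact hx.2.2 h
      rw [mass_of (X ∩ U) hXU, f10, f01, f00, add_zero]
    -- R-sum over `W ∩ U`
    have Rsum : ∑ t ∈ (S ∩ T) ∩ U, (Z * (Z + QA' * QB') * ν t - ∑ s ∈ Uᶜ, Fl t s) =
        Z * (Z + QA' * QB') * (νA tA * νB tB + νA tA * σW + νB tB * τW) - θA * Z * NU * QA' * σW - θB * Z * NU * QB' * τW := by
      rw [Finset.sum_sub_distrib, ← Finset.mul_sum, massU_of (S ∩ T) hW0]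
      have hXU : (tA, tB) ∈ (S ∩ T) ∩ U := Finset.mem_inter.2 ⟨hW0, (hU _).2 (Or.inl rfl)⟩
      rw [Finset.sum_congr rfl fun t _ => hout t, Finset.sum_add_distrib, Finset.sum_ite, Finset.sum_ite,
        Finset.sum_const_zero, Finset.sum_const_zero, add_zero, add_zero]
      have f10 : ((S ∩ T) ∩ U).filter (fun x : QA × QB => x.1 = tA ∧ x.2 ≠ tB) =
          (S ∩ T).filter (fun x => x.1 = tA ∧ x.2 ≠ tB) := by
        ext x; simp only [Finset.mem_filter, Finset.mem_inter, hU]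
        constructor
        · rintro ⟨⟨h1, _⟩, h2⟩; exact ⟨h1, h2⟩
        · rintro ⟨h1, h2⟩; exact ⟨⟨h1, Or.inl h2.1⟩, h2⟩
      have f01 : ((S ∩ T) ∩ U).filter (fun x : QA × QB => x.1 ≠ tA ∧ x.2 = tB) =
          (S ∩ T).filter (fun x => x.1 ≠ tA ∧ x.2 = tB) := by
        ext x; simp only [Finset.mem_filter, Finset.mem_inter, hU]
        constructor
        · rintro ⟨⟨h1, _⟩, h2⟩; exact ⟨h1, h2⟩
        · rintro ⟨h1, h2⟩; exact ⟨⟨h1, Or.inr h2.2⟩, h2⟩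
      rw [f10, f01]
      have e1 : ∑ x ∈ (S ∩ T).filter (fun x : QA × QB => x.1 = tA ∧ x.2 ≠ tB), θA * Z * NU * (νB x.2 * QA') =
          θA * Z * NU * QA' * σW := by
        rw [hσW, Finset.mul_sum]; exact Finset.sum_congr rfl fun x _ => by ring
      have e2 : ∑ x ∈ (S ∩ T).filter (fun x : QA × QB => x.1 ≠ tA ∧ x.2 = tB), θB * Z * NU * (νA x.1 * QB') =
          θB * Z * NU * QB' * τW := by
        rw [hτW, Finset.mul_sum]; exact Finset.sum_congr rfl fun x _ => by ring
      rw [e1, e2]; ring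
    -- facts for the algebra lemma
    have sub10 : ∀ X : Finset (QA × QB), ∑ x ∈ X.filter (fun x => x.1 = tA ∧ x.2 ≠ tB), νB x.2 ≤ QB' := by
      intro X
      rw [sum_fst_fixed tA tB X νB, hQB']
      exact Finset.sum_le_sum_of_subset_of_nonneg (fun b hb => by
        simp only [Finset.mem_filter, Finset.mem_univ, true_and] at hb ⊢; exact hb.2) fun b _ _ => hνB b
    have sub01 : ∀ X : Finset (QA × QB), ∑ x ∈ X.filter (fun x => x.1 ≠ tA ∧ x.2 = tB), νA x.1 ≤ QA' := by
      intro X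
      rw [sum_snd_fixed tA tB X νA, hQA']
      exact Finset.sum_le_sum_of_subset_of_nonneg (fun a ha => by
        simp only [Finset.mem_filter, Finset.mem_univ, true_and] at ha ⊢; exact ha.2) fun a _ _ => hνA a
    have nn10 := fun X : Finset (QA × QB) => Finset.sum_nonneg fun x (_ : x ∈ X.filter fun x => x.1 = tA ∧ x.2 ≠ tB) => hνB x.2
    have nn01 := fun X : Finset (QA × QB) => Finset.sum_nonneg fun x (_ : x ∈ X.filter fun x => x.1 ≠ tA ∧ x.2 = tB) => hνA x.1
    -- Harris in the faces
    have secsum : ∀ X : Finset (QA × QB), (tA, tB) ∈ X →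
        ∑ b ∈ univ.filter (fun b => (tA, b) ∈ X), νB b = νB tB + ∑ x ∈ X.filter (fun x => x.1 = tA ∧ x.2 ≠ tB), νB x.2 := by
      intro X hX
      have hmem : tB ∈ univ.filter (fun b => (tA, b) ∈ X) := by simp [hX]
      rw [sum_fst_fixed tA tB X νB, Finset.filter_ne', Finset.add_sum_erase _ νB hmem]
    have secsum' : ∀ X : Finset (QA × QB), (tA, tB) ∈ X →
        ∑ a ∈ univ.filter (fun a => (a, tB) ∈ X), νA a = νA tA + ∑ x ∈ X.filter (fun x => x.1 ≠ tA ∧ x.2 = tB), νA x.1 := by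
      intro X hX
      have hmem : tA ∈ univ.filter (fun a => (a, tB) ∈ X) := by simp [hX]
      rw [sum_snd_fixed tA tB X νA, Finset.filter_ne', Finset.add_sum_erase _ νA hmem]
    have secW : univ.filter (fun b => (tA, b) ∈ S) ∩ univ.filter (fun b => (tA, b) ∈ T) =
        univ.filter (fun b => (tA, b) ∈ S ∩ T) := by ext b; simp
    have secW' : univ.filter (fun a => (a, tB) ∈ S) ∩ univ.filter (fun a => (a, tB) ∈ T) =
        univ.filter (fun a => (a, tB) ∈ S ∩ T) := by ext a; simp
    have hΦ₁ : (νB tB + σS) * (νB tB + σT) ≤ (νB tB + QB') * (νB tB + σW) := by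
      have h := hHB _ _ (isUpperSet_sectionB hS tA) (isUpperSet_sectionB hT tA)
      rw [secW, secsum S hS0, secsum T hT0, secsum (S ∩ T) hW0, hZB] at h
      exact h
    have hΦ₂ : (νA tA + τS) * (νA tA + τT) ≤ (νA tA + QA') * (νA tA + τW) := by
      have h := hHA _ _ (isUpperSet_sectionA hS tB) (isUpperSet_sectionA hT tB)
      rw [secW', secsum' S hS0, secsum' T hT0, secsum' (S ∩ T) hW0, hZA] at h
      exact h
    have hρS₁ : ρS ≤ QA' * σS := face00_le_face10 hνA hνB tA htA tB hS
    have hρS₂ : ρS ≤ QB' * τS := face00_le_face01 hνA hνB tA tB htB hS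
    have hρT₁ : ρT ≤ QA' * σT := face00_le_face10 hνA hνB tA htA tB hT
    have hρT₂ : ρT ≤ QB' * τT := face00_le_face01 hνA hνB tA tB htB hT
    have alg := dnf_two_pair_hom (νA tA) QA' (νB tB) QB' σS τS ρS σT τT ρT σW τW hPA hQA hPB hQB
      (nn10 S) (sub10 S) (nn01 S) (sub01 S) hρS₁ hρS₂ (nn10 T) (sub10 T) (nn01 T) (sub01 T) hρT₁ hρT₂ hΦ₁ hΦ₂
    -- assemble
    rw [Rsum, eZ, eNU, mass_of S hS0, mass_of T hT0, massU_of S hS0, massU_of T hT0]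
    rw [← sub_nonneg]
    refine (mul_nonneg_iff_of_pos_left hΔ).1 ?_
    refine le_of_le_of_eq alg ?_
    have hDp0 : νA tA * QB' + QA' * νB tB ≠ 0 := by rw [← hDp]; exact ne_of_gt hΔ
    rw [hθA, hθB, hZdef, hNUdef, hDp]
    field_simp
    ring

end Summit.CriticalPhenomena.PercolationContinuityZ3.Theorems.SahiE3DnfTwoCertMain
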